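import Summits.BirchSwinnertonDyer.BirchSwinnertonDyer.Theorems.PrintCFramBottomClassIndexLawFiveLeGenusCrossingHeegnerField
import Summits.BirchSwinnertonDyer.BirchSwinnertonDyer.Theorems.RamifiedSevenEllipticUnitsRubinFormulaZpBsdp
import Summits.BirchSwinnertonDyer.BirchSwinnertonDyer.Theses.PrintCFram
import HarnessLib

set_option linter.dupNamespace false
set_option autoImplicit false

/-!
# Route `PrintCFram`, crux C2 `BottomClassIndexLawFiveLe` (item stmt-BirchSwinnertonDyer-20372), line
# `katz-genus-crossing`: the research stub `stub_heegnerFieldPPart` IS THE CRUX — pointwise and class-wide,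
# modulo the route's own `∃`-form IMC r9 `EllipticUnitIMCFiveLe` and refereed named facts
# (cell `bsd-print-cfram`, seat `bsd-line-cfram-p1`, LEAD g3; helper `--supports` 20372; THEOREMS ONLY)

HONEST FRAMING. Nothing about BSD is proved; no summit statement is proved by this seat; C2, r9 and the leaf stay
OPEN. This file closes, in the kernel, the loop behind the lead's verdict on the line (LEAD g2 report
`Cruxes/BottomClassIndexLawFiveLe/Lines/katz-genus-crossing-lead-g2.md`: «crux-sized BY THEOREM»; LEAD g3 memo
`…-lead-g3.md`: «ATOMIC»), by composing two landed equivalences: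

* g2's `KatzGenusCrossing.heegnerFieldPPart_iff_bsdp` (p611192): at a datum `(K, W₁, C₁)` of the reshaped
  skeleton with `BSD(W₁, p)`, Miller's `BSD(W/K, p)` on `W.baseChange K` ⟺ `BSD(W, p)` (mod GZK, modularity,
  Milne any-model);
* cell `bsd-cm`'s any-prime seam `RubinFormulaZpBsdp.ramifiedCMBottomClassIndexLawAtZp_iff_bsdp_of_imcZp`:
  the crux BODY `X12.O11.RamifiedCMBottomClassIndexLawAtZp W p` ⟺ `BSD(W, p)` given the `∃`-form IMC
  `X12.O11.RamifiedCMEllipticUnitIMCAtZp W p` at `W` (mod modularity, GZ I.(7.3), GZK, Cassels), and its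
  IMC-free half `…IndexLawAtZp_of_bsdp`.

Results (all CONDITIONAL on the displayed named facts; nothing booked):
* `indexLawAtZp_of_heegnerFieldPPart` — ONE datum of S3'' at `(W, p)` already gives the crux body at `(W, p)`;
  NO IMC input in this direction (§1).
* `heegnerFieldPPart_iff_indexLawAtZp_of_imcZp` — given the IMC at `W`, S3'' at any datum ⟺ the crux body (§1).
* `forall_heegnerFieldPPart_of_bottomClassIndexLawFiveLe_of_imcFiveLe` and
  `bottomClassIndexLawFiveLe_iff_heegnerFieldPPart` — CLASS-WIDE: granted r9 and seven refereed facts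
  {`exists_isNewformOf`, Hoffstein–Luo 1997, Burungale–Flach 2024 Cor. 2, GZ I.(7.3), Cassels, Milne 1972},
  `BottomClassIndexLawFiveLe ↔ (GZK → stub_heegnerFieldPPart)` with the stub's REGISTERED signature verbatim (§2).
So in `BSD_p` currency the line's decomposition has no reduction power: its stubs 1–3 are refereed print, and
its stub 4 is the crux again (re-based over a Heegner field). What any line on C2 must import is the ONE
unprinted identity behind both sides — the value of the ramified Rubin-type `p`-adic `L`-function at the
trivial character ([BKNO] Thm. 1.8 at `χ = 𝟙`: `𝟙(L_{p,v_ε}(E)) = exp*_ω(𝟙(v_{−ε})) · log_ω(𝟙(z))`) against the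
Heegner point / `L'(E,1)` — the «BDP-type formula» whose ramified counterpart [BKNO] §1.4 (p. 8) announces
«elsewhere». K7r item 19945 (cell `bsd-cm`) is the 𝒞₇@7 instance of the same atom
(`Theorems/PrintCFramBottomClassIndexLawFiveLeSevenInstance.lean`).

References: [BKNO] arXiv:2608.06879v1 Thm. 1.7, Thm. 1.8, §1.4 (pp. 6–8; preprint; shape only)
[BurungaleKobayashiNakamuraOta2026]; R. Miller, LMS J. Comput. Math. 14 (2011) Def. 1.1 [Miller2011LMS];
J. S. Milne, Invent. Math. 17 (1972) §1 Thm. 1 [Milne1972ArithmeticAV]; J. Hoffstein – W. Luo, Int. Math. Res.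
Not. 1997 [HoffsteinLuo1997]; A. Burungale – M. Flach, Camb. J. Math. 12 (2024) Cor. 2 [BurungaleFlach2024];
B. Gross – D. Zagier (1986) Thm. I.(7.3) [GrossZagier1986]; J. W. S. Cassels (1965) [Cassels1965ArithmeticVIII].
-/

noncomputable section

open scoped Classical

open WeierstrassCurve Literature.NumberTheory.EllipticCurves Literature.NumberTheory.EllipticCurves.Rank1Residual
  Summit.BirchSwinnertonDyer.Rank1Residual Summit.BirchSwinnertonDyer.Rank1Residual.X12
  Summit.BirchSwinnertonDyer.Rank1Residual.X12.O11
  Summit.BirchSwinnertonDyer.BirchSwinnertonDyer.Theorems.RamifiedSevenEllipticUnits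

namespace Summit.BirchSwinnertonDyer.BirchSwinnertonDyer.Theorems.PrintCFram.KatzGenusCrossing

/-! ### §1. Pointwise: one datum of the research stub versus the crux body at `(W, p)` -/

section Pointwise

variable {W : WeierstrassCurve ℚ} [W.IsElliptic] [W.IsGloballyMinimal] {p : ℕ} [Fact p.Prime]

/-- **One datum of S3'' gives the crux body at `(W, p)` — no IMC input.** For a globally minimal `W/ℚ` of
analytic rank `≤ 1`, an imaginary quadratic `K`, a globally minimal model `W₁` of `W^{(d_K)}` of analytic rank
`0` with `BSD(W₁, p)`: Miller's `BSD(W/K, p)` on `W.baseChange K` implies the value law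
`X12.O11.RamifiedCMBottomClassIndexLawAtZp W p` (the body of C2 / of K7r's 19945 at `p = 7`). Route:
`heegnerFieldPPart_iff_bsdp` (`.1`: `BSD(W, p)`), then cell `bsd-cm`'s IMC-free seam
`RubinFormulaZpBsdp.ramifiedCMBottomClassIndexLawAtZp_of_bsdp`. CONDITIONAL on GZK, modularity, Cassels, Milne
any-model (displayed). [cite: Miller2011LMS, Def. 1.1 (arXiv:1010.2431 p. 3)] [cite: Milne1972ArithmeticAV, §1 Thm. 1]
[cite: Cassels1965ArithmeticVIII] -/
theorem indexLawAtZp_of_heegnerFieldPPart (hGZK : rank_eq_analyticRank_of_analyticRank_le_one)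
    (hmod : hasEntireLFunction_rat) (hCassels : bsdRHS_eq_of_isIsogenous)
    (hMilneC : Milne1972.bsdQuotient_baseChange_quadratic_anyModel)
    (hr : W.analyticRank ≤ 1) (K : Type) [Field K] [NumberField K] (hK : IsImaginaryQuadratic K)
    {W₁ : WeierstrassCurve ℚ} [W₁.IsElliptic] [W₁.IsGloballyMinimal] {C₁ : VariableChange ℚ}
    (htw : C₁ • W₁ = W.quadraticTwist (NumberField.discr K : ℚ)) (hr₁ : W₁.analyticRank = 0)
    (hB₁ : BSDp W₁ p) (hOver : BSDpOver (W.baseChange K) p) :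
    RamifiedCMBottomClassIndexLawAtZp W p :=
  RubinFormulaZpBsdp.ramifiedCMBottomClassIndexLawAtZp_of_bsdp hCassels hmod hGZK hr
    ((heegnerFieldPPart_iff_bsdp hGZK hmod hMilneC hr K hK htw hr₁ hB₁).1 hOver)

/-- **Given the `∃`-form IMC at `W`, S3'' at any datum ⟺ the crux body at `(W, p)`.** For a globally minimal
CM `W/ℚ` of analytic rank one at a CM-ramified `p ≥ 5` with `X12.O11.RamifiedCMEllipticUnitIMCAtZp W p`
(the body of r9 / of K7r's 19944 at `p = 7`), and any datum `(K, W₁, C₁)` with `BSD(W₁, p)`: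
`BSDpOver (W.baseChange K) p ↔ RamifiedCMBottomClassIndexLawAtZp W p` — `heegnerFieldPPart_iff_bsdp` followed
by cell `bsd-cm`'s `RubinFormulaZpBsdp.ramifiedCMBottomClassIndexLawAtZp_iff_bsdp_of_imcZp`. CONDITIONAL on
GZK, modularity, GZ I.(7.3), Cassels, Milne any-model (displayed). [cite: Miller2011LMS, Def. 1.1 (arXiv:1010.2431 p. 3)]
[cite: GrossZagier1986, Thm. I.(7.3)] [cite: Milne1972ArithmeticAV, §1 Thm. 1] -/
theorem heegnerFieldPPart_iff_indexLawAtZp_of_imcZp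
    (hGZK : rank_eq_analyticRank_of_analyticRank_le_one) (hmod : hasEntireLFunction_rat)
    (hGZ : GrossZagier1986_thm_I_7_3) (hCassels : bsdRHS_eq_of_isIsogenous)
    (hMilneC : Milne1972.bsdQuotient_baseChange_quadratic_anyModel)
    (hCM : W.HasCM) (hram : CMRamified W p) (h5 : 5 ≤ p) (hr : W.analyticRank = 1)
    (h1 : RamifiedCMEllipticUnitIMCAtZp W p)
    (K : Type) [Field K] [NumberField K] (hK : IsImaginaryQuadratic K)
    {W₁ : WeierstrassCurve ℚ} [W₁.IsElliptic] [W₁.IsGloballyMinimal] {C₁ : VariableChange ℚ}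
    (htw : C₁ • W₁ = W.quadraticTwist (NumberField.discr K : ℚ)) (hr₁ : W₁.analyticRank = 0)
    (hB₁ : BSDp W₁ p) :
    BSDpOver (W.baseChange K) p ↔ RamifiedCMBottomClassIndexLawAtZp W p :=
  (heegnerFieldPPart_iff_bsdp hGZK hmod hMilneC hr.le K hK htw hr₁ hB₁).trans
    (RubinFormulaZpBsdp.ramifiedCMBottomClassIndexLawAtZp_iff_bsdp_of_imcZp hmod hGZ hGZK hCassels h1 hCM
      hram h5 hr).symm

end Pointwise

/-! ### §2. Class-wide: `BottomClassIndexLawFiveLe ↔ (GZK → stub_heegnerFieldPPart)` granted r9 and facts -/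

/-- **C2 ∧ r9 ⟹ the research stub, class-wide** (registered signature of `stub_heegnerFieldPPart` verbatim,
behind C2's own antecedent GZK): at every member and every datum with `BSD(W₁, p)`, the crux body and the IMC
at `W` give `BSD(W, p)` (cell `bsd-cm`'s seam), hence `BSD(W/K, p)` (g2's exactness). The Heegner hypotheses
of the datum are not used. CONDITIONAL on r9 `Theses.PrintCFram.EllipticUnitIMCFiveLe` and the displayed facts
{modularity, GZ I.(7.3), Cassels, Milne}. [cite: Miller2011LMS, Def. 1.1 (arXiv:1010.2431 p. 3)]
[cite: GrossZagier1986, Thm. I.(7.3)] [cite: Milne1972ArithmeticAV, §1 Thm. 1] -/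
theorem forall_heegnerFieldPPart_of_bottomClassIndexLawFiveLe_of_imcFiveLe
    (hmod : hasEntireLFunction_rat) (hGZ : GrossZagier1986_thm_I_7_3) (hCassels : bsdRHS_eq_of_isIsogenous)
    (hMilneC : Milne1972.bsdQuotient_baseChange_quadratic_anyModel)
    (h9 : Summit.BirchSwinnertonDyer.BirchSwinnertonDyer.Theses.PrintCFram.EllipticUnitIMCFiveLe)
    (h2 : Summit.BirchSwinnertonDyer.BirchSwinnertonDyer.Theses.PrintCFram.BottomClassIndexLawFiveLe)
    (hGZK : rank_eq_analyticRank_of_analyticRank_le_one) :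
    ∀ (W : WeierstrassCurve ℚ) [W.IsElliptic] [W.IsGloballyMinimal] (p : ℕ) [Fact p.Prime],
      W.HasCM → CMRamified W p → 5 ≤ p → W.analyticRank = 1 →
      ∀ (K : Type) [Field K] [NumberField K] (W₁ : WeierstrassCurve ℚ) [W₁.IsElliptic] [W₁.IsGloballyMinimal]
        (C₁ : VariableChange ℚ), IsImaginaryQuadratic K → SatisfiesHeegnerHypothesis (W.conductorNorm ℤ) K →
        SatisfiesHeegnerHypothesis p K → C₁ • W₁ = W.quadraticTwist (NumberField.discr K : ℚ) →
        W₁.analyticRank = 0 → BSDp W₁ p → BSDpOver (W.baseChange K) p :=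
  fun W _ _ p _ hCM hram h5 hr K _ _ _ _ _ _ hK _ _ htw hr₁ hB₁ =>
    (heegnerFieldPPart_iff_indexLawAtZp_of_imcZp hGZK hmod hGZ hCassels hMilneC hCM hram h5 hr
        (h9 W p hCM hram h5 hr) K hK htw hr₁ hB₁).2 (h2 hGZK W p hCM hram h5 hr)

/-- **THE RESEARCH STUB IS THE CRUX (class-wide).** Granted the route's `∃`-form IMC r9
`Theses.PrintCFram.EllipticUnitIMCFiveLe` and seven refereed named facts — modularity `exists_isNewformOf`,
Hoffstein–Luo 1997 (a Heegner field with a rank-zero twist exists: g2's `exists_heegnerField_rankZeroTwist`),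
Burungale–Flach 2024 Cor. 2 (rank-zero `BSD_p` of the CM twist), Gross–Zagier I.(7.3), Cassels, Milne 1972
any-model — the crux `Theses.PrintCFram.BottomClassIndexLawFiveLe` is EQUIVALENT to the registered research
stub `stub_heegnerFieldPPart` of `Cruxes/BottomClassIndexLawFiveLe/Lines/katz_genus_crossing.lean` placed
behind the crux's own antecedent GZK. `→`: the previous theorem; `←`: g2's assembly
`crux_of_heegnerField_pPartOver`. So the line's stub 4 has exactly the strength of the crux: nothing smaller
is left to prove on this line. CONDITIONAL on the displayed hypotheses; nothing booked.
[cite: HoffsteinLuo1997, Theorem (§1, pp. 435–436)] [cite: BurungaleFlach2024, Thm. 1.1 and Cor. 2]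
[cite: Milne1972ArithmeticAV, §1 Thm. 1] [cite: GrossZagier1986, Thm. I.(7.3)] [cite: Cassels1965ArithmeticVIII]
[cite: Miller2011LMS, Def. 1.1 (arXiv:1010.2431 p. 3)] -/
theorem bottomClassIndexLawFiveLe_iff_heegnerFieldPPart (hnf : ModularForms.exists_isNewformOf)
    (hHL : HoffsteinLuo1997_exists_twist_L_one_ne_zero) (hBF : bsdTriple_of_hasCM_of_L_one_ne_zero)
    (hGZ : GrossZagier1986_thm_I_7_3) (hCassels : bsdRHS_eq_of_isIsogenous)
    (hMilneC : Milne1972.bsdQuotient_baseChange_quadratic_anyModel)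
    (h9 : Summit.BirchSwinnertonDyer.BirchSwinnertonDyer.Theses.PrintCFram.EllipticUnitIMCFiveLe) :
    Summit.BirchSwinnertonDyer.BirchSwinnertonDyer.Theses.PrintCFram.BottomClassIndexLawFiveLe ↔
      (rank_eq_analyticRank_of_analyticRank_le_one →
        ∀ (W : WeierstrassCurve ℚ) [W.IsElliptic] [W.IsGloballyMinimal] (p : ℕ) [Fact p.Prime],
          W.HasCM → CMRamified W p → 5 ≤ p → W.analyticRank = 1 →
          ∀ (K : Type) [Field K] [NumberField K] (W₁ : WeierstrassCurve ℚ) [W₁.IsElliptic]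
            [W₁.IsGloballyMinimal] (C₁ : VariableChange ℚ), IsImaginaryQuadratic K →
            SatisfiesHeegnerHypothesis (W.conductorNorm ℤ) K → SatisfiesHeegnerHypothesis p K →
            C₁ • W₁ = W.quadraticTwist (NumberField.discr K : ℚ) → W₁.analyticRank = 0 → BSDp W₁ p →
            BSDpOver (W.baseChange K) p) :=
  ⟨fun h2 hGZK => forall_heegnerFieldPPart_of_bottomClassIndexLawFiveLe_of_imcFiveLe
      (hasEntireLFunction_rat_of_exists_isNewformOf hnf) hGZ hCassels hMilneC h9 h2 hGZK,
    fun h hGZK W _ _ p _ hCM hram h5 hr =>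
      crux_of_heegnerField_pPartOver hnf hHL hBF hCassels hMilneC (h hGZK) hGZK W p hCM hram h5 hr⟩

end Summit.BirchSwinnertonDyer.BirchSwinnertonDyer.Theorems.PrintCFram.KatzGenusCrossing

end
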